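import Mathlib
import HarnessLib
import HarnessLib.Audit
import Summits.SmoothPoincare4.Statement
import Summits.SmoothPoincare4.SmoothPoincare4.Theses.ZeroSurgeryExotic

/-!
# Record of the dropped route item `ZeroSurgeryExotic.Assembly2` (stmt-SmoothPoincare4-0367)

Route `SmoothPoincare4/ZeroSurgeryExotic` lost its item `Assembly2` (stmt-SmoothPoincare4-0367, the
route's KILL SWITCH "the `0`-surgery type determines smooth sliceness", closed `moot`) on
2026-08-16T14:15:59Z, when the gate's items-cap autofix dropped the duplicate assembly-kinded items
`Assembly2`, `Assembly3`, `Assembly4` (keeping the one `closes` uses). The gate-written route file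
`Theses/ZeroSurgeryExotic.lean` therefore no longer declares the constant, while three Theorems files —
append-only, whose statement texts may not change — still name it as a hypothesis or inside `↔`/`¬`:
`Theorems/ZseCruxRasmussen/Negative/Shape.lean` (`not_crux_of_assembly2`),
`Theorems/ZseThesis/Negative/Position.lean` (`not_zseThesis_iff_assembly2`, `zseThesis_iff_not_assembly2`) and
`Theorems/ZeroSurgeryExoticAssembly2Position.lean` (`assembly2_iff_not_zseThesis`, …), so those modules
stopped building ("Unknown identifier", full build of 2026-08-16T23:32Z). This module re-declares the
constant under its ORIGINAL fully-qualified name with its ORIGINAL definiens (the item's ledger signature,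
verbatim), in the route file's namespace and `open` context, so that those records elaborate again once
they add the single line `import Summits.SmoothPoincare4.SmoothPoincare4.Theorems.ZeroSurgeryExoticAssembly2Record`
(pattern `Theorems/DebrisQuantaRobustDecayQuantumRecord.lean`,
`Theorems/TwoAndHalfDScalarLiftRecord.lean`). It is NOT a route item (no `route_item` attribute) and it
is OPEN (equivalent to `¬ ZseThesis`; implied by `SmoothPoincare4`): a `Prop`, never asserted.
-/

namespace Summit.SmoothPoincare4.SmoothPoincare4.Theses.ZeroSurgeryExotic

open scoped BigOperators Topology Manifold Classical MeasureTheory ProbabilityTheory Matrix InnerProductSpace ComplexConjugate ContinuousMap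
open Filter Set Function TopologicalSpace MeasureTheory

/-- **Record of the dropped route item `Assembly2`** = stmt-SmoothPoincare4-0367 (ledger signature
verbatim; NOT a route item; OPEN — the route's kill switch, `¬ ZseThesis` in `∀`-form, a consequence of
`SmoothPoincare4` by the Manolescu–Piccirillo assembly argument): **the `0`-surgery type determines
smooth sliceness** — if two knots `K, K'` have a common `0`-surgery `Y` and `K` is smoothly slice, then
`K'` is smoothly slice (Manolescu–Piccirillo 2023, §1; Kirby Problem 1.19-type question). Re-declared
only so that the negative-knowledge records naming it keep elaborating (see the module docstring;
deliberately untagged — a project-posed route statement, not a Literature fact). -/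
def Assembly2 : Prop :=
  ∀ (K K' : Literature.Topology.FourManifolds.Knot) (Y : Type) [TopologicalSpace Y] [ChartedSpace (EuclideanSpace ℝ (Fin 3)) Y], Literature.Topology.FourManifolds.IsIntegralSurgery (𝓡 3) Y K 0 → Literature.Topology.FourManifolds.IsIntegralSurgery (𝓡 3) Y K' 0 → K.IsSmoothlySlice → K'.IsSmoothlySlice

end Summit.SmoothPoincare4.SmoothPoincare4.Theses.ZeroSurgeryExotic
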